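import Summits.BirchSwinnertonDyer.BirchSwinnertonDyer.Theorems.PrintCf2RubinValueTwoKatzMeasureJZeroFrameSeven
import Mathlib.AlgebraicGeometry.EllipticCurve.VariableChange
import HarnessLib

/-!
# PSI-PIN: on the `cm7` frame a Grössencharacter `ψ` with de Shalit's properties II.1.5 (ii)(iii)(iv) and conductor
# supported above `7` has `ψ(v) = α₀` — the trace-one generator of `v ∣ 2`, NOT `−α₀`

Cell `bsd-print-cf2`, width seat `bsd-line-cf2-p1-w5` g17; print leaf stmt-BirchSwinnertonDyer-24720 (`j = 0` twin), crux 20368.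
`--supports stmt-BirchSwinnertonDyer-24720` (helper, Theses-free).  THEOREMS ONLY (no `def`, no named fact, no `sorry`); nothing is
closed; no summit statement is proved by this seat; BSD is not proved by any of this.

WHY: the fifth print `DeShalit1987.prop15_grossencharacterReciprocity` (P5, p764292) ∃-binds `(𝔣, ψ)`; its clause (iii)
`span {ψ 𝔞} = 𝔞` gives `ψ(v) = ±α₀` only (`𝓞_Kˣ = ±1`), while BOTH the Euler datum `hW` of the seam identity (p764371: `u·2 = α₀`
against `ψhat = ψ(v)^{−m}` from (γ) + P5 (vii)) AND the (α)-assembly's (he) (`β` with `βψ(v) ≡ 1` used against the `[u·2]`-division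
tower) need `ψ(v) = u·2 = α₀` EXACTLY (the trace-`1` root singled out by FRAME-7's `α₀² − α₀ + 2 = 0`; for odd `m` / odd level the
sign matters).  Classically this is Deuring's «`ψ(𝔭)` reduces to Frobenius» (de Shalit II.1.10), not among P5's clauses.  THIS FILE
pins the sign ELEMENTARILY from P5's clauses (ii) (iv) and the SUPPORT of `𝔣` (from (v): `49a1` has good reduction at every `w ∤ 7`,
so `𝔣` is coprime to every prime not containing `7`):

* `units_eq_one_or_eq_neg_one` — `d_K < −4 ⟹ 𝓞_Kˣ = {±1}` (norm form on an integral basis);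
* `dvd_pow_three_mul_seven_pow_sub_one` — with `θ := 2α₀ − 1` (`θ² = −7`): **`θ^{j+1} ∣ α₀^{3·7^j} − 1`** (`α₀³ − 1 = −θ(1 − α₀)`; `x ≡ 1 (θ)`
  ⟹ `1 + x + ⋯ + x⁶ ≡ 7 ≡ 0 (θ)`), i.e. the order of `α₀` modulo `7^∞` is ODD;
* `exists_seven_pow_mem` — `𝔣 ≠ ⊥` coprime to every height-one prime not containing `7` ⟹ `7^N ∈ 𝔣` (radical);
* §5 `cm7Model_good`, `cm7Short_variableChange` ((u,r,s,t) = (μ⁻¹, −μ⁻²/4, μ⁻¹/2, 0) carries `⟨0,0,0,−g₂/4,−g₃/4⟩`,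
  `(g₂,g₃) = (μ⁻⁴·35/4, μ⁻⁶·49/8)`, to `[1,−1,0,−2,−1]`), ★ `isCoprime_of_clause_v[_cm7]` — clause (v) ⇒ `𝔣` coprime to every `w ∌ 7`;
* ★★ `psi_apply_eq_generator` — **`ψ v = α₀`**: `ψ(v) = εα₀`, `ψ(v)^f = ψ(v^f) = ψ((α₀^f)) = α₀^f` for the odd `f = 3·7^{2N+1}` with
  `α₀^f ≡ 1 (𝔣)`, hence `ε^f = 1`, `ε = 1`;  `psi_apply_sq_sub_self_add_two` — equivalently `ψ(v)² − ψ(v) + 2 = 0`.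

## References
* [deShalit1987] E. de Shalit, *Iwasawa theory of elliptic curves with complex multiplication* (1987), II.1.4–1.5 (15)–(18), II.1.8 (i),
  II.1.10 Lemma (`ψ(𝔭)` and the formal group at `𝔭`).
* [Cox2013] D. A. Cox, *Primes of the form x² + ny²*, 2nd ed., §7.A (norm form; units of imaginary quadratic orders).
-/

-- the summit namespace `Summit.BirchSwinnertonDyer.BirchSwinnertonDyer` repeats the problem name by design (D-0017)
set_option linter.dupNamespace false
set_option autoImplicit false

noncomputable section

open NumberField IsDedekindDomain Module Finset
open Literature.NumberTheory.QuadraticFields.Quadratic Literature.NumberTheory.EllipticCurves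

namespace Summit.BirchSwinnertonDyer.BirchSwinnertonDyer.Theorems.PrintCf2.KatzMeasureJZeroTop

variable {K : Type} [Field K] [NumberField K]

/-! ### §1. Units of an imaginary quadratic field with `d_K < −4` -/

/-- **`𝓞_Kˣ = {±1}` when `[K:ℚ] = 2` and `d_K < −4`**: on an integral basis `(1, ω)` a unit `u = x + yω` has norm
`x² + txy − my² = 1` (non-negative definite form), so `4 = (2x + ty)² − d_K y²` forces `y = 0`, `x = ±1`. [cite: Cox2013, §7.A] -/
theorem units_eq_one_or_eq_neg_one (hK : IsImaginaryQuadratic K) (hd : NumberField.discr K < -4) (u : (𝓞 K)ˣ) :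
    u = 1 ∨ u = -1 := by
  classical
  obtain ⟨b, hb⟩ := exists_basis_zero_eq_one hK.1
  have hω : b 1 * b 1 = ((b.repr (b 1 * b 1) 0 : ℤ) : 𝓞 K) + ((b.repr (b 1 * b 1) 1 : ℤ) : 𝓞 K) * b 1 :=
    basis_one_mul_self_eq b hb
  have hD := discr_eq_sq_add_four_mul b hb
  generalize b.repr (b 1 * b 1) 0 = m at hω hD
  generalize b.repr (b 1 * b 1) 1 = t at hω hD
  have hneg : t ^ 2 + 4 * m < 0 := hD ▸ hK.discr_neg
  set x : ℤ := b.repr (u : 𝓞 K) 0 with hx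
  set y : ℤ := b.repr (u : 𝓞 K) 1 with hy
  have hu : (u : 𝓞 K) = (x : 𝓞 K) + (y : 𝓞 K) * b 1 := eq_repr_add_repr_mul_of_basis b hb _
  have hnorm : Algebra.norm ℤ (u : 𝓞 K) = x ^ 2 + t * x * y - m * y ^ 2 := by
    conv_lhs => rw [hu]
    exact norm_intCast_add_intCast_mul b hb hω x y
  have hn1 : x ^ 2 + t * x * y - m * y ^ 2 = 1 := by
    have hunit : IsUnit (Algebra.norm ℤ (u : 𝓞 K)) := (Units.isUnit u).map _
    rw [hnorm, Int.isUnit_iff] at hunit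
    rcases hunit with h | h
    · exact h
    · exact absurd h (by nlinarith [normForm_nonneg hneg x y])
  have h4 : 4 = (2 * x + t * y) ^ 2 - (t ^ 2 + 4 * m) * y ^ 2 := by
    have := four_mul_normForm t m x y; rw [hn1] at this; linarith
  have hy0 : y = 0 := by
    by_contra hy0
    have hy1 : 1 ≤ y ^ 2 := by
      have : y ^ 2 ≠ 0 := pow_ne_zero 2 hy0
      have : 0 ≤ y ^ 2 := sq_nonneg y
      omega
    rw [← hD] at h4
    nlinarith [sq_nonneg (2 * x + t * y)]
  have hx1 : x = 1 ∨ x = -1 := by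
    rw [hy0] at hn1
    have hx2 : x ^ 2 = 1 ^ 2 := by linarith
    exact sq_eq_sq_iff_eq_or_eq_neg.mp hx2
  rcases hx1 with hx1 | hx1
  · left; ext; rw [hu, hy0, hx1]; push_cast; ring
  · right; ext; rw [Units.val_neg, Units.val_one, hu, hy0, hx1]; push_cast; ring

/-! ### §2. The order of `α₀` modulo `7^∞` is odd -/

/-- `α₀³ − 1 = −(2α₀ − 1)(1 − α₀)` for `α₀² − α₀ + 2 = 0`. [folklore] -/
theorem pow_three_sub_one_eq {R : Type*} [CommRing R] {α₀ : R} (hα₀ : α₀ ^ 2 - α₀ + 2 = 0) :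
    α₀ ^ 3 - 1 = -((2 * α₀ - 1) * (1 - α₀)) := by
  linear_combination (α₀ - 1) * hα₀

/-- `x ≡ 1 (mod θ)` and `θ ∣ 7` ⟹ `θ ∣ 1 + x + ⋯ + x⁶`. [folklore] -/
theorem dvd_geom_sum_seven {R : Type*} [CommRing R] {θ x : R} (hx : θ ∣ x - 1) (h7 : θ ∣ 7) :
    θ ∣ ∑ i ∈ range 7, x ^ i := by
  have h : ∑ i ∈ range 7, x ^ i = (∑ i ∈ range 7, (x ^ i - 1)) + 7 := by
    rw [Finset.sum_sub_distrib]; simp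
  rw [h]
  refine dvd_add (Finset.dvd_sum fun i _ ↦ ?_) h7
  exact hx.trans (sub_one_dvd_pow_sub_one x i)

/-- ★ **The order of `α₀` modulo powers of `θ = 2α₀ − 1` (`θ² = −7`) is odd**: `θ^{j+1} ∣ α₀^{3·7^j} − 1` for every `j`.
[cite: Cox2013, §7.A] -/
theorem dvd_pow_three_mul_seven_pow_sub_one {R : Type*} [CommRing R] {α₀ : R} (hα₀ : α₀ ^ 2 - α₀ + 2 = 0) (j : ℕ) :
    (2 * α₀ - 1) ^ (j + 1) ∣ α₀ ^ (3 * 7 ^ j) - 1 := by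
  induction j with
  | zero =>
    rw [zero_add, pow_one, pow_zero, mul_one, pow_three_sub_one_eq hα₀]
    exact (dvd_mul_right _ _).neg_right
  | succ j ih =>
    -- `x^7 − 1 = (Σ_{i<7} x^i)(x − 1)`, `x = α₀^{3·7^j}`
    have hθ7 : (2 * α₀ - 1) ∣ (7 : R) :=
      ⟨-(2 * α₀ - 1), by linear_combination (4 : R) * hα₀⟩
    have hθ1 : (2 * α₀ - 1) ∣ α₀ ^ (3 * 7 ^ j) - 1 := (dvd_pow_self _ (Nat.succ_ne_zero j)).trans ih
    have hgeom := dvd_geom_sum_seven hθ1 hθ7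
    have hfac : α₀ ^ (3 * 7 ^ (j + 1)) - 1 = (∑ i ∈ range 7, (α₀ ^ (3 * 7 ^ j)) ^ i) * (α₀ ^ (3 * 7 ^ j) - 1) := by
      rw [geom_sum_mul, ← pow_mul]; ring_nf
    rw [hfac, pow_succ, mul_comm ((2 * α₀ - 1) ^ (j + 1))]
    exact mul_dvd_mul hgeom ih

/-- `θ^{2N} = (−7)^N` for `θ = 2α₀ − 1`. [folklore] -/
theorem two_mul_sub_one_pow_two_mul {R : Type*} [CommRing R] {α₀ : R} (hα₀ : α₀ ^ 2 - α₀ + 2 = 0) (N : ℕ) :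
    (2 * α₀ - 1) ^ (2 * N) = (-7) ^ N := by
  rw [pow_mul, sq_two_mul_sub_one_eq_neg_seven hα₀]

/-! ### §3. The support of `𝔣` -/

omit [NumberField K] in
/-- **A non-zero ideal coprime to every height-one prime not containing `7` contains a power of `7`** (`7` lies in every prime
above `𝔣`, hence in its radical). [folklore] -/
theorem exists_seven_pow_mem {𝔣 : Ideal (𝓞 K)} (h𝔣0 : 𝔣 ≠ ⊥)
    (h𝔣7 : ∀ w : HeightOneSpectrum (𝓞 K), (7 : 𝓞 K) ∉ w.asIdeal → IsCoprime w.asIdeal 𝔣) :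
    ∃ N : ℕ, (7 : 𝓞 K) ^ N ∈ 𝔣 := by
  have h7 : (7 : 𝓞 K) ∈ 𝔣.radical := by
    rw [Ideal.radical_eq_sInf, Submodule.mem_sInf]
    rintro P ⟨hP𝔣, hP⟩
    by_contra h7P
    have hP0 : P ≠ ⊥ := fun h ↦ h𝔣0 (le_bot_iff.mp (h ▸ hP𝔣))
    have hcop := h𝔣7 ⟨P, hP, hP0⟩ h7P
    exact hP.ne_top (Ideal.eq_top_iff_one _ |>.mpr (by
      have := Ideal.isCoprime_iff_sup_eq.mp hcop
      rw [sup_eq_left.mpr hP𝔣] at this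
      rw [this]; trivial))
  exact h7

/-! ### §4. `ψ(v) = α₀` -/

omit [NumberField K] in
/-- Multiplicativity on powers of an ideal prime to `𝔣` (P5 clause (ii) iterated). [cite: deShalit1987, II.1.4 (13)] -/
theorem psi_pow_eq {𝔣 : Ideal (𝓞 K)} {ψ : Ideal (𝓞 K) → 𝓞 K}
    (hmul : ∀ 𝔞 𝔟 : Ideal (𝓞 K), IsCoprime 𝔞 𝔣 → IsCoprime 𝔟 𝔣 → ψ (𝔞 * 𝔟) = ψ 𝔞 * ψ 𝔟)
    (h1 : ψ ⊤ = 1) {𝔞 : Ideal (𝓞 K)} (h𝔞 : IsCoprime 𝔞 𝔣) (n : ℕ) : ψ (𝔞 ^ n) = ψ 𝔞 ^ n := by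
  induction n with
  | zero => rw [pow_zero, pow_zero, Ideal.one_eq_top, h1]
  | succ n ih => rw [pow_succ, hmul _ _ (h𝔞.pow_left) h𝔞, ih, pow_succ]

omit [NumberField K] in
/-- `ψ(⊤) = 1` from clause (iv) (`1 − 1 = 0 ∈ 𝔣`). [cite: deShalit1987, II.1.4 (13)] -/
theorem psi_top_eq_one {𝔣 : Ideal (𝓞 K)} {ψ : Ideal (𝓞 K) → 𝓞 K}
    (hone : ∀ α : 𝓞 K, α - 1 ∈ 𝔣 → ψ (Ideal.span {α}) = α) : ψ ⊤ = 1 := by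
  have h := hone 1 (by rw [sub_self]; exact 𝔣.zero_mem)
  rwa [Ideal.span_singleton_one] at h

set_option maxHeartbeats 800000 in
/-- ★★ **PSI-PIN: `ψ(v) = α₀`.** Let `K` be imaginary quadratic with `d_K = −7`, `v ∣ 2` with the trace-one generator `α₀`
(`α₀² − α₀ + 2 = 0`, FRAME-7), and let `(𝔣, ψ)` satisfy de Shalit II.1.5's clauses (ii) multiplicativity on ideals prime to `𝔣`,
(iii) `span{ψ 𝔞} = 𝔞`, (iv) `ψ((α)) = α` for `α ≡ 1 (𝔣)` (the fifth print's (ii)–(iv) VERBATIM), with `𝔣 ≠ 0` coprime to every prime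
not containing `7` (from clause (v): good reduction of `49a1` away from `7`).  Then `ψ(v)` is `α₀` itself, not `−α₀`: the order of `α₀`
modulo `𝔣 ⊇ (7^N)` is odd. This is the content of Deuring's «`ψ(𝔭)` lifts Frobenius» (de Shalit II.1.10) in the lane's currency,
obtained without reduction theory. [cite: deShalit1987, II.1.10 Lemma] -/
theorem psi_apply_eq_generator (hK : IsImaginaryQuadratic K) (hdK : NumberField.discr K = -7)
    {𝔣 : Ideal (𝓞 K)} (h𝔣0 : 𝔣 ≠ ⊥) {ψ : Ideal (𝓞 K) → 𝓞 K}
    (hmul : ∀ 𝔞 𝔟 : Ideal (𝓞 K), IsCoprime 𝔞 𝔣 → IsCoprime 𝔟 𝔣 → ψ (𝔞 * 𝔟) = ψ 𝔞 * ψ 𝔟)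
    (hgen : ∀ 𝔞 : Ideal (𝓞 K), IsCoprime 𝔞 𝔣 → Ideal.span {ψ 𝔞} = 𝔞)
    (hone : ∀ α : 𝓞 K, α - 1 ∈ 𝔣 → ψ (Ideal.span {α}) = α)
    (h𝔣7 : ∀ w : HeightOneSpectrum (𝓞 K), (7 : 𝓞 K) ∉ w.asIdeal → IsCoprime w.asIdeal 𝔣)
    {v : HeightOneSpectrum (𝓞 K)} (hv : ((2 : ℕ) : 𝓞 K) ∈ v.asIdeal)
    {α₀ : 𝓞 K} (hv0 : v.asIdeal = Ideal.span {α₀}) (hα₀ : α₀ ^ 2 - α₀ + 2 = 0) :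
    ψ v.asIdeal = α₀ := by
  classical
  -- `v` is prime to `𝔣` (`7 ∉ v`: `1 = 7 − 3·2`)
  have h7v : (7 : 𝓞 K) ∉ v.asIdeal := by
    intro h7
    have h2 : (2 : 𝓞 K) ∈ v.asIdeal := by exact_mod_cast hv
    have h1 : (1 : 𝓞 K) ∈ v.asIdeal := by
      have : (1 : 𝓞 K) = 7 - 3 * 2 := by norm_num
      rw [this]; exact v.asIdeal.sub_mem h7 (v.asIdeal.mul_mem_left _ h2)
    exact v.isPrime.ne_top ((Ideal.eq_top_iff_one _).mpr h1)
  have hvcop : IsCoprime v.asIdeal 𝔣 := h𝔣7 v h7v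
  -- `ψ v = α₀ · ε`
  have hspan : Ideal.span {ψ v.asIdeal} = Ideal.span {α₀} := by rw [hgen _ hvcop, hv0]
  obtain ⟨ε, hε⟩ := Ideal.span_singleton_eq_span_singleton.mp hspan.symm
  -- `7^N ∈ 𝔣`, `f := 3·7^{2N+1}` odd with `α₀^f − 1 ∈ 𝔣`
  obtain ⟨N, hN⟩ := exists_seven_pow_mem h𝔣0 h𝔣7
  have hdvd := dvd_pow_three_mul_seven_pow_sub_one hα₀ (2 * N + 1)
  have hfmem : α₀ ^ (3 * 7 ^ (2 * N + 1)) - 1 ∈ 𝔣 := by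
    obtain ⟨c, hc⟩ := hdvd
    rw [hc, show 2 * N + 1 + 1 = 2 * (N + 1) by ring, two_mul_sub_one_pow_two_mul hα₀ (N + 1), pow_succ, mul_comm ((-7 : 𝓞 K) ^ N),
      show (-7 : 𝓞 K) = -1 * 7 by ring, mul_pow, neg_one_mul]
    refine 𝔣.mul_mem_right _ (𝔣.mul_mem_left _ ?_)
    rw [neg_pow, mul_comm]
    exact 𝔣.mul_mem_right _ hN
  -- `ψ(v)^f = α₀^f`
  have hpow : ψ v.asIdeal ^ (3 * 7 ^ (2 * N + 1)) = α₀ ^ (3 * 7 ^ (2 * N + 1)) := by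
    rw [← psi_pow_eq hmul (psi_top_eq_one hone) hvcop, hv0, Ideal.span_singleton_pow, hone _ hfmem]
  -- `ε = ±1`, and `ε = −1` is impossible since `f` is odd and `α₀ ≠ 0`
  have hα0 : α₀ ≠ 0 := by
    rintro rfl
    norm_num at hα₀
  rcases units_eq_one_or_eq_neg_one hK (by rw [hdK]; norm_num) ε with h1 | h1
  · rw [← hε, h1, Units.val_one, mul_one]
  · exfalso
    rw [h1, Units.val_neg, Units.val_one, mul_neg_one] at hε
    have hodd : Odd (3 * 7 ^ (2 * N + 1)) := Odd.mul (by decide) (Odd.pow (by decide))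
    rw [← hε, neg_pow, hodd.neg_one_pow, neg_one_mul] at hpow
    have : (2 : 𝓞 K) * α₀ ^ (3 * 7 ^ (2 * N + 1)) = 0 := by linear_combination -hpow
    rcases mul_eq_zero.mp this with h | h
    · norm_num at h
    · exact hα0 (pow_eq_zero_iff (by positivity) |>.mp h)

/-- ★ **PSI-PIN, equation form**: `ψ(v)² − ψ(v) + 2 = 0` — `ψ(v)` is the trace-one root (`= u·2` of the lane's datum, `= e⁻¹(1 − ϖ)`
of `cm7Padic_exists_formalGroupLaw_eq_ltF`), so `ψhat = ψ(v)^{−m} = α₀^{−m}` in the seam's Euler datum. [cite: deShalit1987, II.1.10 Lemma] -/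
theorem psi_apply_sq_sub_self_add_two (hK : IsImaginaryQuadratic K) (hdK : NumberField.discr K = -7)
    {𝔣 : Ideal (𝓞 K)} (h𝔣0 : 𝔣 ≠ ⊥) {ψ : Ideal (𝓞 K) → 𝓞 K}
    (hmul : ∀ 𝔞 𝔟 : Ideal (𝓞 K), IsCoprime 𝔞 𝔣 → IsCoprime 𝔟 𝔣 → ψ (𝔞 * 𝔟) = ψ 𝔞 * ψ 𝔟)
    (hgen : ∀ 𝔞 : Ideal (𝓞 K), IsCoprime 𝔞 𝔣 → Ideal.span {ψ 𝔞} = 𝔞)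
    (hone : ∀ α : 𝓞 K, α - 1 ∈ 𝔣 → ψ (Ideal.span {α}) = α)
    (h𝔣7 : ∀ w : HeightOneSpectrum (𝓞 K), (7 : 𝓞 K) ∉ w.asIdeal → IsCoprime w.asIdeal 𝔣)
    {v : HeightOneSpectrum (𝓞 K)} (hv : ((2 : ℕ) : 𝓞 K) ∈ v.asIdeal)
    {α₀ : 𝓞 K} (hv0 : v.asIdeal = Ideal.span {α₀}) (hα₀ : α₀ ^ 2 - α₀ + 2 = 0) :
    ψ v.asIdeal ^ 2 - ψ v.asIdeal + 2 = 0 := by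
  rw [psi_apply_eq_generator hK hdK h𝔣0 hmul hgen hone h𝔣7 hv hv0 hα₀]; exact hα₀

/-! ### §5. Clause (v) ⇒ the support of `𝔣`: good models of the `cm7` lattice curves away from `7` -/

/-- **The `cm7` minimal model `[1, −1, 0, −2, −1]` (`49a1`, `Δ = −7³`) is a good model at every prime `w ∌ 7`** of `K`:
integral coefficients and unit discriminant, in the valuation currency of P5's clause (v). [cite: deShalit1987, II.1.8 (i)] -/
theorem cm7Model_good (w : HeightOneSpectrum (𝓞 K)) (h7 : (7 : 𝓞 K) ∉ w.asIdeal) :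
    w.valuation K (⟨1, -1, 0, -2, -1⟩ : WeierstrassCurve K).a₁ ≤ 1 ∧
    w.valuation K (⟨1, -1, 0, -2, -1⟩ : WeierstrassCurve K).a₂ ≤ 1 ∧
    w.valuation K (⟨1, -1, 0, -2, -1⟩ : WeierstrassCurve K).a₃ ≤ 1 ∧
    w.valuation K (⟨1, -1, 0, -2, -1⟩ : WeierstrassCurve K).a₄ ≤ 1 ∧
    w.valuation K (⟨1, -1, 0, -2, -1⟩ : WeierstrassCurve K).a₆ ≤ 1 ∧
    w.valuation K (⟨1, -1, 0, -2, -1⟩ : WeierstrassCurve K).Δ = 1 := by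
  have hnat : ∀ n : ℕ, w.valuation K (n : K) ≤ 1 := fun n ↦ by
    rw [show (n : K) = algebraMap (𝓞 K) K n from (map_natCast _ n).symm, HeightOneSpectrum.valuation_of_algebraMap]
    exact w.intValuation_le_one _
  have hΔ : (⟨1, -1, 0, -2, -1⟩ : WeierstrassCurve K).Δ = -((7 : ℕ) : K) ^ 3 := by
    simp only [WeierstrassCurve.Δ, WeierstrassCurve.b₂, WeierstrassCurve.b₄, WeierstrassCurve.b₆, WeierstrassCurve.b₈]
    push_cast; norm_num
  refine ⟨?_, ?_, ?_, ?_, ?_, ?_⟩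
  · change w.valuation K 1 ≤ 1; rw [Valuation.map_one]
  · change w.valuation K (-1) ≤ 1; rw [Valuation.map_neg, Valuation.map_one]
  · change w.valuation K 0 ≤ 1; rw [Valuation.map_zero]; exact zero_le_one
  · change w.valuation K (-2) ≤ 1; rw [Valuation.map_neg]; exact_mod_cast hnat 2
  · change w.valuation K (-1) ≤ 1; rw [Valuation.map_neg, Valuation.map_one]
  · have h7K : ((7 : ℕ) : K) = algebraMap (𝓞 K) K (7 : 𝓞 K) := by
      rw [← map_natCast (algebraMap (𝓞 K) K) 7]; norm_num
    rw [hΔ, Valuation.map_neg, Valuation.map_pow, h7K, HeightOneSpectrum.valuation_of_algebraMap,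
      HeightOneSpectrum.intValuation_eq_one_iff.mpr h7, one_pow]

/-- **The homothety family of `cm7` lattices has `K`-rational good models**: for `μ ∈ Kˣ`, the curve
`y² = 4x³ − g₂x − g₃` with `(g₂, g₃) = (μ⁻⁴·35/4, μ⁻⁶·49/8)` (invariants `c₄/12, c₆/216` of `49a1` scaled by the homothety `μ`), in
P5's normal form `⟨0, 0, 0, −g₂/4, −g₃/4⟩`, is carried to `[1, −1, 0, −2, −1]` by the change `(u, r, s, t) = (μ⁻¹, −μ⁻²/4, μ⁻¹/2, 0)`.
[cite: deShalit1987, II.1.8 (i)] -/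
theorem cm7Short_variableChange (μ : Kˣ) :
    (⟨μ⁻¹, -((μ : K)⁻¹ ^ 2) / 4, (μ : K)⁻¹ / 2, 0⟩ : WeierstrassCurve.VariableChange K) •
        (⟨0, 0, 0, -(((μ : K)⁻¹ ^ 4 * (35 / 4)) / 4), -(((μ : K)⁻¹ ^ 6 * (49 / 8)) / 4)⟩ : WeierstrassCurve K) =
      ⟨1, -1, 0, -2, -1⟩ := by
  have hμ : (μ : K) ≠ 0 := μ.ne_zero
  ext <;> simp only [WeierstrassCurve.variableChange_def, inv_inv] <;> field_simp <;> ring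

/-- ★ **Clause (v) ⇒ `𝔣` is supported above `7`**: if P5's clause (v) holds for the curve `⟨0,0,0,−g₂₀/4,−g₃₀/4⟩` and that curve is
carried by some change of variables to the `cm7` model `[1,−1,0,−2,−1]`, then `𝔣` is coprime to every prime `w ∌ 7` — the hypothesis
`h𝔣7` of `psi_apply_eq_generator`. [cite: deShalit1987, II.1.8 (i)] -/
theorem isCoprime_of_clause_v {𝔣 : Ideal (𝓞 K)} {g₂₀ g₃₀ : K}
    (hv5 : ∀ 𝔭 : HeightOneSpectrum (𝓞 K),
      (∃ (C : WeierstrassCurve.VariableChange K) (W : WeierstrassCurve K),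
        W = C • (⟨0, 0, 0, -(g₂₀ / 4), -(g₃₀ / 4)⟩ : WeierstrassCurve K) ∧
        𝔭.valuation K W.a₁ ≤ 1 ∧ 𝔭.valuation K W.a₂ ≤ 1 ∧ 𝔭.valuation K W.a₃ ≤ 1 ∧
        𝔭.valuation K W.a₄ ≤ 1 ∧ 𝔭.valuation K W.a₆ ≤ 1 ∧ 𝔭.valuation K W.Δ = 1) →
      IsCoprime 𝔭.asIdeal 𝔣)
    (hC : ∃ C : WeierstrassCurve.VariableChange K,
      C • (⟨0, 0, 0, -(g₂₀ / 4), -(g₃₀ / 4)⟩ : WeierstrassCurve K) = ⟨1, -1, 0, -2, -1⟩)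
    (w : HeightOneSpectrum (𝓞 K)) (h7 : (7 : 𝓞 K) ∉ w.asIdeal) : IsCoprime w.asIdeal 𝔣 := by
  obtain ⟨C, hC⟩ := hC
  exact hv5 w ⟨C, _, hC.symm, cm7Model_good w h7⟩

/-- The same for the homothety family `(g₂₀, g₃₀) = (μ⁻⁴·35/4, μ⁻⁶·49/8)` (change supplied by `cm7Short_variableChange`).
[cite: deShalit1987, II.1.8 (i)] -/
theorem isCoprime_of_clause_v_cm7 {𝔣 : Ideal (𝓞 K)} (μ : Kˣ)
    (hv5 : ∀ 𝔭 : HeightOneSpectrum (𝓞 K),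
      (∃ (C : WeierstrassCurve.VariableChange K) (W : WeierstrassCurve K),
        W = C • (⟨0, 0, 0, -(((μ : K)⁻¹ ^ 4 * (35 / 4)) / 4), -(((μ : K)⁻¹ ^ 6 * (49 / 8)) / 4)⟩ : WeierstrassCurve K) ∧
        𝔭.valuation K W.a₁ ≤ 1 ∧ 𝔭.valuation K W.a₂ ≤ 1 ∧ 𝔭.valuation K W.a₃ ≤ 1 ∧
        𝔭.valuation K W.a₄ ≤ 1 ∧ 𝔭.valuation K W.a₆ ≤ 1 ∧ 𝔭.valuation K W.Δ = 1) →
      IsCoprime 𝔭.asIdeal 𝔣)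
    (w : HeightOneSpectrum (𝓞 K)) (h7 : (7 : 𝓞 K) ∉ w.asIdeal) : IsCoprime w.asIdeal 𝔣 :=
  isCoprime_of_clause_v hv5 ⟨_, cm7Short_variableChange μ⟩ w h7

end Summit.BirchSwinnertonDyer.BirchSwinnertonDyer.Theorems.PrintCf2.KatzMeasureJZeroTop

end
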